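import Summits.BirchSwinnertonDyer.BirchSwinnertonDyer.Theorems.CyclotomicUntwistPSUntwistingCharacterParity
import Summits.BirchSwinnertonDyer.BirchSwinnertonDyer.Theorems.CyclotomicUntwistSpectralHalo
import HarnessLib

/-!
# The route's analytic constant `κ = 9η(−1)/α²` when `α` is a root of `X² − aX + 3` (route `CyclotomicUntwist`,
# crux K1 `PSRankOneLowerHalfAtThree`): `κ = η(−1)·(a − α)²`, and `κ = −3·W₃(E) ∈ ℚ` on the `a_w = 0` rows

Cell `pub/bsd-wall` (D-0145 line `route-BirchSwinnertonDyer-CyclotomicUntwist`), seat `bsd-line-cycu-p3` (gen 5).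
Helper toward K1 (stmt-BirchSwinnertonDyer-21580) / K2 (stmt-21581). THEOREMS ONLY (no definition, no named fact,
no `sorry`); BSD is not proved by this file and no crux is.

LAW L-a3 (crux memo `Cruxes/PSRankOneLowerHalfAtThree/LAW-La3-KERNEL-v2.md`; model-level half landed as
`CyclotomicUntwistGNineSpecialFibre`): on a principal-series row the untwisted `U₃`-eigenvalue `α = a₃(g)` —
D1's free parameter in `IsPSCyclotomicLFunctionOf W η α 𝓛` — is a root of `X² − a_w X + 3`, where
`a_w ∈ {0, ±3}` is the Frobenius trace of `E` over `ℚ₃(ζ₉)` (informal: Fontaine's `D_pst` + Saito's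
local–global compatibility; NOT asserted here). The theorems below are the typed shadow: they take
`α² = a·α − 3` (any `a`) resp. `α² = −3` (the `a_w = 0` third of the rows: `133` of the `416` K1/K2 classes with
`N < 5·10⁵`, `K1-ROW-ATLAS-v1`) as a HYPOTHESIS on `α` and compute the constant `κ = 9η(−1)/α²` ADOPTED by the
route pen for the definition want D4 (pinned in `CyclotomicUntwistFiniteSlopeSeparatedPinned`, cycu-p5 g6):

* `pin_eq_of_sq_eq`: `α² = aα − 3 ⟹ 9η(−1)/α² = η(−1)·(a − α)²` (`a − α = 3/α` is the conjugate root);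
* `pin_eq_of_sq_eq_neg_three`: `α² = −3 ⟹ 9η(−1)/α² = −3·η(−1)`;
* on a PS row with `η` primitive of order Kraus's inertia order (`PSUntwistingCharacterParity`, `η(−1) = W₃`):
  **`pin_eq_rootNumberThree_mul_sq_of_psRow : 9η(−1)/α² = W₃(E)·(a − α)²`** and
  **`pin_eq_neg_three_mul_rootNumberThree_of_psRow : α² = −3 ⟹ 9η(−1)/α² = −3·W₃(E)`** — on the `a_w = 0`
  rows the constant is RATIONAL (`±3`), independent of `α`, of `η` beyond its order, and of any embedding.

References: O. G. Rizzo, Compositio Math. 136 (2003), Table II [Rizzo2003]; B. Mazur, J. Tate, J. Teitelbaum,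
Invent. Math. 84 (1986), §I.14 [MazurTateTeitelbaum1986Invent]; T. Saito, Invent. Math. 129 (1997) 607–620 [Saito1997].
-/

open scoped Classical

open WeierstrassCurve DirichletCharacter
  Literature.NumberTheory.EllipticCurves.Rank1Residual
  Summit.BirchSwinnertonDyer.Rank1Residual.Additive
  Summit.BirchSwinnertonDyer.BirchSwinnertonDyer.Theorems

-- single-conjunct summit: `Summit.BirchSwinnertonDyer.BirchSwinnertonDyer.…` repeats the name by design
set_option linter.dupNamespace false
set_option autoImplicit false

noncomputable section

namespace Summit.BirchSwinnertonDyer.BirchSwinnertonDyer.Theorems.PSUntwistingPin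

variable (η : DirichletCharacter ℂ_[3] (3 ^ 2))

/-- If `α² = a·α − 3` then `α·(a − α) = 3`: the other root of `X² − aX + 3` is `a − α = 3/α`. [folklore] -/
theorem mul_sub_self_eq_three {α a : ℂ_[3]} (hα : α ^ 2 = a * α - 3) : α * (a - α) = 3 := by
  linear_combination -hα

/-- A root of `X² − aX + 3` is non-zero. [folklore] -/
theorem ne_zero_of_sq_eq {α a : ℂ_[3]} (hα : α ^ 2 = a * α - 3) : α ≠ 0 := by
  rintro rfl
  norm_num at hα

/-- **`κ = η(−1)·(a − α)²`**: for `α` a root of `X² − aX + 3`, `9η(−1)/α²` equals `η(−1)` times the square of the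
conjugate root `a − α = 3/α` (cf. `pin_eq_of_mul_eq_three` of `CyclotomicUntwistFiniteSlopeSeparatedPinned`).
[cite: MazurTateTeitelbaum1986Invent, §I.14 (interpolation factor at the trivial character)] -/
theorem pin_eq_of_sq_eq {α a : ℂ_[3]} (hα : α ^ 2 = a * α - 3) :
    9 * η (-1) / α ^ 2 = η (-1) * (a - α) ^ 2 := by
  have h0 : α ≠ 0 := ne_zero_of_sq_eq hα
  have h3 : a - α = 3 / α := by
    rw [eq_div_iff h0, mul_comm]
    exact mul_sub_self_eq_three hα
  rw [h3, div_pow]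
  ring

/-- **The `a_w = 0` rows: `κ = −3·η(−1)`** (`α² = −3`, i.e. `α = ±√−3`). [folklore] -/
theorem pin_eq_of_sq_eq_neg_three {α : ℂ_[3]} (hα : α ^ 2 = -3) :
    9 * η (-1) / α ^ 2 = -3 * η (-1) := by
  rw [hα]
  ring

variable (W : WeierstrassCurve ℚ) [W.IsElliptic] [W.IsGloballyMinimal]

/-- **General PS rows, sign from the table: `κ = W₃(E)·(a − α)²`** for `α² = aα − 3` and `η` primitive mod `9`
of order Kraus's inertia order (by LAW L-a3, informally, `a = a_w(E) ∈ {0, ±3}` and `a − α = ᾱ`).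
[cite: Rizzo2003, Table II (p. 4)] -/
theorem pin_eq_rootNumberThree_mul_sq_of_psRow (hO6 : ClassO6 W 3)
    (hev : Even (padicValInt 3 W.minimalDiscriminantInt))
    (hps : W.minimalDiscriminantInt / 3 ^ padicValInt 3 W.minimalDiscriminantInt % 3 = 1)
    (hη : η.IsPrimitive) (hmatch : orderOf η = krausInertiaOrderThree W) {α a : ℂ_[3]}
    (hα : α ^ 2 = a * α - 3) :
    9 * η (-1) / α ^ 2 = (W.rootNumberThree : ℂ_[3]) * (a - α) ^ 2 := by
  rw [pin_eq_of_sq_eq η hα,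
    PSUntwistingCharacterParity.eta_neg_one_eq_rootNumberThree_of_psRow W η hO6 hev hps hη hmatch]

/-- **The `a_w = 0` rows with the sign read in Rizzo's table: `κ = −3·W₃(E) ∈ {±3} ⊂ ℚ`.** On a PS row
(`ClassO6`, `v` even, `Δ′ ≡ 1`), for `η` primitive mod `9` of order Kraus's inertia order and `α² = −3`:
`9η(−1)/α² = −3·W.rootNumberThree` — `+3` on Kodaira `IV/IV*`, `−3` on `II/II*`. [cite: Rizzo2003, Table II (p. 4)] -/
theorem pin_eq_neg_three_mul_rootNumberThree_of_psRow (hO6 : ClassO6 W 3)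
    (hev : Even (padicValInt 3 W.minimalDiscriminantInt))
    (hps : W.minimalDiscriminantInt / 3 ^ padicValInt 3 W.minimalDiscriminantInt % 3 = 1)
    (hη : η.IsPrimitive) (hmatch : orderOf η = krausInertiaOrderThree W) {α : ℂ_[3]} (hα : α ^ 2 = -3) :
    9 * η (-1) / α ^ 2 = -3 * (W.rootNumberThree : ℂ_[3]) := by
  rw [pin_eq_of_sq_eq_neg_three η hα,
    PSUntwistingCharacterParity.eta_neg_one_eq_rootNumberThree_of_psRow W η hO6 hev hps hη hmatch]

/-- The `a_w = 0` rows, explicit sign: `κ = −3` if `4 ∣ v₃(Δ_min)` (Kodaira `II/II*`) and `κ = +3` if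
`v₃(Δ_min) ≡ 2 (mod 4)` (`IV/IV*`). [cite: Rizzo2003, Table II (p. 4)] -/
theorem pin_eq_ite_of_psRow (hO6 : ClassO6 W 3)
    (hev : Even (padicValInt 3 W.minimalDiscriminantInt))
    (hps : W.minimalDiscriminantInt / 3 ^ padicValInt 3 W.minimalDiscriminantInt % 3 = 1)
    (hη : η.IsPrimitive) (hmatch : orderOf η = krausInertiaOrderThree W) {α : ℂ_[3]} (hα : α ^ 2 = -3) :
    9 * η (-1) / α ^ 2 = if padicValInt 3 W.minimalDiscriminantInt % 4 = 2 then 3 else -3 := by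
  rw [pin_eq_neg_three_mul_rootNumberThree_of_psRow η W hO6 hev hps hη hmatch hα,
    PSRootNumberThree.rootNumberThree_of_psRow W hO6 hev hps]
  split_ifs <;> norm_num

/-! ### §2 (appended) The matching shadow pins `η` up to inversion

The route matches the untwisting character `η` mod `9` to the inertia character `χ` of `W` at `3`
(`η|_I = χ`); the tree's typed shadow is `η.IsPrimitive ∧ orderOf η = krausInertiaOrderThree W`
(`PSUntwistingCharacterParity`). This shadow already determines `η` UP TO `η ↦ η⁻¹`, i.e. up to the route's
`σ`-conjugation (`h_ψ̄ = σ h_ψ`, `L^{η̄}_W = σ ∘ L^{η}_W`, `PSConjugateLFunctionsThree`): two primitive characters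
mod `9` with values in `ℂ₃` and the same order are equal or inverse to each other — there are exactly two
primitive cube roots and two primitive sixth roots of unity in a field, `z` and `z⁻¹`. -/

section MatchUpToInversion

variable (η η' : DirichletCharacter ℂ_[3] (3 ^ 2))

/-- `η⁻¹(2) = η(2)⁻¹` (values in the field `ℂ₃`). [folklore] -/
theorem inv_apply_two : η⁻¹ 2 = (η 2)⁻¹ :=
  MulChar.inv_apply_eq_inv' η 2

/-- Two roots of `X² + X + 1` (primitive cube roots of unity) in a field are equal or mutually inverse.
[folklore] -/
theorem eq_or_eq_inv_of_cube_roots {z z' : ℂ_[3]} (hz : z ^ 2 + z + 1 = 0) (hz' : z' ^ 2 + z' + 1 = 0) :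
    z' = z ∨ z' = z⁻¹ := by
  have hzinv : z⁻¹ = -1 - z :=
    inv_eq_of_mul_eq_one_right (by linear_combination -hz)
  have hprod : (z' - z) * (z' - z⁻¹) = 0 := by
    rw [hzinv]; linear_combination hz' - hz
  rcases mul_eq_zero.mp hprod with h | h
  · exact Or.inl (sub_eq_zero.mp h)
  · exact Or.inr (sub_eq_zero.mp h)

/-- Two roots of `X² − X + 1` (primitive sixth roots of unity) in a field are equal or mutually inverse.
[folklore] -/
theorem eq_or_eq_inv_of_sixth_roots {z z' : ℂ_[3]} (hz : z ^ 2 - z + 1 = 0) (hz' : z' ^ 2 - z' + 1 = 0) :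
    z' = z ∨ z' = z⁻¹ := by
  have hzinv : z⁻¹ = 1 - z :=
    inv_eq_of_mul_eq_one_right (by linear_combination -hz)
  have hprod : (z' - z) * (z' - z⁻¹) = 0 := by
    rw [hzinv]; linear_combination hz' - hz
  rcases mul_eq_zero.mp hprod with h | h
  · exact Or.inl (sub_eq_zero.mp h)
  · exact Or.inr (sub_eq_zero.mp h)

/-- For `η` primitive mod `9` of order `3`: `z = η(2)` satisfies `z² + z + 1 = 0`
(`z⁶ = 1`, `z³ = η(−1) = 1`, `z² ≠ 1`). [cite: Washington1997, Ch. 3] -/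
theorem apply_two_cube_root (hη : η.IsPrimitive) (h3 : orderOf η = 3) : η 2 ^ 2 + η 2 + 1 = 0 := by
  have he : η (-1) = 1 := (PSUntwistingCharacterParity.even_iff_orderOf_eq_three η hη).mpr h3
  rw [PSUntwistingCharacterParity.eta_neg_one_eq_pow_three] at he
  have h2 := PSUntwistingCharacterParity.apply_two_sq_ne_one η hη
  -- `z³ − 1 = (z − 1)(z² + z + 1) = 0` and `z ≠ 1`
  have hz1 : η 2 - 1 ≠ 0 := by
    intro h; apply h2; rw [sub_eq_zero.mp h, one_pow]
  have hprod : (η 2 - 1) * (η 2 ^ 2 + η 2 + 1) = 0 := by linear_combination he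
  exact (mul_eq_zero.mp hprod).resolve_left hz1

/-- For `η` primitive mod `9` of order `6`: `z = η(2)` satisfies `z² − z + 1 = 0`
(`z³ = η(−1) = −1`, `z ≠ −1` as `z² ≠ 1`). [cite: Washington1997, Ch. 3] -/
theorem apply_two_sixth_root (hη : η.IsPrimitive) (h6 : orderOf η = 6) : η 2 ^ 2 - η 2 + 1 = 0 := by
  have ho : η (-1) = -1 := (PSUntwistingCharacterParity.odd_iff_orderOf_eq_six η hη).mpr h6
  rw [PSUntwistingCharacterParity.eta_neg_one_eq_pow_three] at ho
  have h2 := PSUntwistingCharacterParity.apply_two_sq_ne_one η hη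
  -- `z³ + 1 = (z + 1)(z² − z + 1) = 0` and `z ≠ −1`
  have hz1 : η 2 + 1 ≠ 0 := by
    intro h; apply h2
    have : η 2 = -1 := by linear_combination h
    rw [this]; norm_num
  have hprod : (η 2 + 1) * (η 2 ^ 2 - η 2 + 1) = 0 := by linear_combination ho
  exact (mul_eq_zero.mp hprod).resolve_left hz1

/-- **Two primitive characters mod `9` of the same order are equal or inverse to each other.**
[cite: Washington1997, Ch. 3] -/
theorem eq_or_eq_inv_of_orderOf_eq (hη : η.IsPrimitive) (hη' : η'.IsPrimitive)
    (h : orderOf η' = orderOf η) : η' = η ∨ η' = η⁻¹ := by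
  have hz : η' 2 = η 2 ∨ η' 2 = (η 2)⁻¹ := by
    rcases PSUntwistingCharacterParity.orderOf_eq_three_or_six η hη with h3 | h6
    · exact eq_or_eq_inv_of_cube_roots (apply_two_cube_root η hη h3)
        (apply_two_cube_root η' hη' (h.trans h3))
    · exact eq_or_eq_inv_of_sixth_roots (apply_two_sixth_root η hη h6)
        (apply_two_sixth_root η' hη' (h.trans h6))
  rcases hz with hz | hz
  · exact Or.inl (PSUntwistingCharacterParity.eq_of_apply_two_eq' η' η hz)
  · refine Or.inr (PSUntwistingCharacterParity.eq_of_apply_two_eq' η' η⁻¹ ?_)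
    rw [hz, inv_apply_two]

variable (W : WeierstrassCurve ℚ) [W.IsGloballyMinimal]

/-- **The matching shadow pins `η` up to inversion.** If `η` and `η'` are primitive mod `9` and both have
order `krausInertiaOrderThree W` — the typed shadow of «restriction to inertia = the inertia character of
`W` at `3`» — then `η' = η` or `η' = η⁻¹`: the two admissible untwisting characters of a PS row are the
conjugate pair `{η, η̄}` of the route's `σ`-symmetry. [cite: Kraus1990, Théorème 1 (p = 3)] [cite: Washington1997, Ch. 3] -/
theorem eq_or_eq_inv_of_match (hη : η.IsPrimitive) (hη' : η'.IsPrimitive)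
    (hmatch : orderOf η = krausInertiaOrderThree W) (hmatch' : orderOf η' = krausInertiaOrderThree W) :
    η' = η ∨ η' = η⁻¹ :=
  eq_or_eq_inv_of_orderOf_eq η η' hη hη' (hmatch'.trans hmatch.symm)

/-- The two admissible characters have the same parity (`η⁻¹(−1) = η(−1)`), so the sign `η(−1) = W₃` of the
pin does not see the choice. [folklore] -/
theorem inv_apply_neg_one : η⁻¹ (-1) = η (-1) := by
  rw [MulChar.inv_apply_eq_inv']
  rcases PSUntwistingCharacterParity.eta_neg_one_eq_one_or η with h | h <;> rw [h] <;> norm_num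

end MatchUpToInversion

/-! ### §3 (appended) The relation `α² = aα − 3` with `‖a‖ ≤ ‖3‖₃` forces slope `½`

LAW L-a3 gives `α² = a_w·α − 3` with `a_w ∈ {0, ±3}`, in particular `‖a_w‖₃ ≤ ‖3‖₃`. This alone forces
`‖α‖₃² = ‖3‖₃` (`v₃(α) = ½`, the slope the route's D1 object needs; `norm_pin_of_norm_sq` of
`CyclotomicUntwistFiniteSlopeSeparatedPinned` takes exactly this as hypothesis): `α(a − α) = 3` and the
ultrametric inequality leave no other possibility. -/

section Slope

/-- **Slope `½` from the quadratic relation.** If `α² = a·α − 3` in `ℂ₃` with `‖a‖ ≤ ‖3‖` (e.g. `a ∈ {0, ±3}`),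
then `‖α‖² = ‖3‖ = 3⁻¹`. [folklore] -/
theorem norm_sq_eq_of_sq_eq {α a : ℂ_[3]} (hα : α ^ 2 = a * α - 3) (ha : ‖a‖ ≤ ‖(3 : ℂ_[3])‖) :
    ‖α‖ ^ 2 = (3 : ℝ)⁻¹ := by
  have h3 : ‖(3 : ℂ_[3])‖ = (3 : ℝ)⁻¹ := PSWeightHalo.norm_three
  have hprod : ‖α‖ * ‖a - α‖ = (3 : ℝ)⁻¹ := by
    rw [← h3, ← norm_mul, mul_sub_self_eq_three hα]
  rw [h3] at ha
  have hαn : 0 ≤ ‖α‖ := norm_nonneg _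
  have hda : ‖a - α‖ ≤ max ‖a‖ ‖α‖ := by
    have := IsUltrametricDist.norm_add_le_max a (-α)
    rwa [norm_neg, ← sub_eq_add_neg] at this
  have hαa : ‖α‖ ≤ max ‖α - a‖ ‖a‖ := by
    have := IsUltrametricDist.norm_add_le_max (α - a) a
    rwa [sub_add_cancel] at this
  rcases lt_trichotomy (‖α‖ ^ 2) (3 : ℝ)⁻¹ with hlt | heq | hgt
  · exfalso
    rcases le_or_gt ‖α‖ (3 : ℝ)⁻¹ with hle | hlt'
    · have hmax : ‖a - α‖ ≤ (3 : ℝ)⁻¹ := hda.trans (max_le ha hle)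
      have : (3 : ℝ)⁻¹ ≤ (3 : ℝ)⁻¹ * (3 : ℝ)⁻¹ := by
        calc (3 : ℝ)⁻¹ = ‖α‖ * ‖a - α‖ := hprod.symm
          _ ≤ (3 : ℝ)⁻¹ * (3 : ℝ)⁻¹ := mul_le_mul hle hmax (norm_nonneg _) (by norm_num)
      norm_num at this
    · have hmax : ‖a - α‖ ≤ ‖α‖ := hda.trans (max_le (ha.trans hlt'.le) le_rfl)
      have : (3 : ℝ)⁻¹ ≤ ‖α‖ ^ 2 := by
        calc (3 : ℝ)⁻¹ = ‖α‖ * ‖a - α‖ := hprod.symm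
          _ ≤ ‖α‖ * ‖α‖ := mul_le_mul_of_nonneg_left hmax hαn
          _ = ‖α‖ ^ 2 := (sq ‖α‖).symm
      linarith
  · exact heq
  · exfalso
    have hα3 : (3 : ℝ)⁻¹ < ‖α‖ := by
      by_contra hle
      push Not at hle
      have : ‖α‖ ^ 2 ≤ (3 : ℝ)⁻¹ * (3 : ℝ)⁻¹ := by
        rw [sq]; exact mul_le_mul hle hle hαn (by norm_num)
      nlinarith
    have hge : ‖α‖ ≤ ‖α - a‖ := by
      by_contra hlt'
      push Not at hlt'
      have : max ‖α - a‖ ‖a‖ < ‖α‖ := max_lt hlt' (ha.trans_lt hα3)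
      linarith
    have : ‖α‖ ^ 2 ≤ (3 : ℝ)⁻¹ := by
      calc ‖α‖ ^ 2 = ‖α‖ * ‖α‖ := sq ‖α‖
        _ ≤ ‖α‖ * ‖a - α‖ := mul_le_mul_of_nonneg_left (by rwa [norm_sub_rev]) hαn
        _ = (3 : ℝ)⁻¹ := hprod
    linarith

/-- The admissible traces `a ∈ {0, ±3}` have `‖a‖ ≤ ‖3‖` in `ℂ₃`. [folklore] -/
theorem norm_le_norm_three_of_mem {a : ℤ} (ha : a = 0 ∨ a = 3 ∨ a = -3) :
    ‖((a : ℤ) : ℂ_[3])‖ ≤ ‖(3 : ℂ_[3])‖ := by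
  rcases ha with rfl | rfl | rfl
  · simp
  · norm_num
  · rw [Int.cast_neg, norm_neg]; norm_num

/-- **LAW L-a3's shape forces slope `½`**: `α² = a·α − 3` with `a ∈ {0, ±3}` implies `‖α‖² = 3⁻¹`.
[cite: MazurTateTeitelbaum1986Invent, §I.14 (one allowable root of slope < 1)] -/
theorem norm_sq_eq_of_sq_eq_int {α : ℂ_[3]} {a : ℤ} (ha : a = 0 ∨ a = 3 ∨ a = -3)
    (hα : α ^ 2 = (a : ℂ_[3]) * α - 3) : ‖α‖ ^ 2 = (3 : ℝ)⁻¹ :=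
  norm_sq_eq_of_sq_eq hα (norm_le_norm_three_of_mem ha)

/-- `‖η(−1)‖ = 1`. [folklore] -/
theorem norm_apply_neg_one_eq_one : ‖η (-1)‖ = 1 := by
  rcases PSUntwistingCharacterParity.eta_neg_one_eq_one_or η with h | h <;> rw [h] <;> simp

/-- **Valuation of the pin from the quadratic relation**: `α² = a·α − 3`, `‖a‖ ≤ ‖3‖` imply
`‖9η(−1)/α²‖ = 3⁻¹` (`v₃(κ) = 1`). [cite: MazurTateTeitelbaum1986Invent, §I.14] -/
theorem norm_pin_of_sq_eq {α a : ℂ_[3]} (hα : α ^ 2 = a * α - 3) (ha : ‖a‖ ≤ ‖(3 : ℂ_[3])‖) :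
    ‖9 * η (-1) / α ^ 2‖ = (3 : ℝ)⁻¹ := by
  have h9 : ‖(9 : ℂ_[3])‖ = (3 : ℝ)⁻¹ * (3 : ℝ)⁻¹ := by
    rw [show (9 : ℂ_[3]) = 3 * 3 by norm_num, norm_mul, PSWeightHalo.norm_three]
  rw [norm_div, norm_mul, norm_pow, norm_sq_eq_of_sq_eq hα ha, h9, norm_apply_neg_one_eq_one]
  field_simp

end Slope

end Summit.BirchSwinnertonDyer.BirchSwinnertonDyer.Theorems.PSUntwistingPin

end
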